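import Summits.BirchSwinnertonDyer.BirchSwinnertonDyer.Theorems.RamifiedHeegnerPairLeafUpperMembersOfReadingOptimalOffRows
import Summits.BirchSwinnertonDyer.BirchSwinnertonDyer.Theorems.RamifiedHeegnerPairGss2LowerAtThreeRankOneNonTowerOfNonSurjThree
import Summits.BirchSwinnertonDyer.BirchSwinnertonDyer.Theorems.SemiOrdinaryEisensteinDescentWildKolyvaginUpperAtThreeTight
import Summits.BirchSwinnertonDyer.BirchSwinnertonDyer.Theorems.ClassRecordThreeShimuraKolyvaginOrderBoundAtThreeTransport
import Summits.BirchSwinnertonDyer.Rank1Residual.AdditivePotMult.RankZeroShaAnIdentity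
import Literature.NumberTheory.EllipticCurves.LeadingTermProofs
import HarnessLib

/-!
# Route `RamifiedHeegnerPair` (rev 9) — the research stub Σ★″ of the lines `splitkolyvagin` v5 (U₁, 26022) /
# `splitkolyvagin0` v4 (U₀, 26024) is TIGHT — DATA LEVEL: at one Heegner frame of a tower-onto curve, BSD₃ of the
# two members and print FORBID every McCallum certificate beyond the Tamagawa–Manin budget (lead prover bsd-line-rhp-p2 g6;
# `--supports stmt-BirchSwinnertonDyer-26022`, helper; BSD is not proved by any of this)

WHY. The registered research residue of both U-lines is ONE orientation-free statement Σ★″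
(`stub_leafSigmaStarDivisibilityAtThreeOptimalOffRows` = hypothesis `hStar` of p622097): Σ-form global `3`-power
divisibility of the derived Heegner points `P_n ∈ E(K[n])` at the additive `3`, `3^{s′} ∣ P_n` for every
`s′ ≤ ord₃ ∏ c_ℓ(E) + v₃(c)` and every square-free `n` of Kolyvagin primes of index `≥ s′`. The kernel knows Σ★″ is
SUFFICIENT (with PUB⁺, S2, L₁, L₀: p622097). THIS FILE proves it is NECESSARY on the rows where Kolyvagin's structure
theorem is available (`ρ̄_{E,3}` onto — on the leaf this is the whole `3`-adic tower, p622801): a FAILURE of Σ★″ at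
`s′ = M + 1` is exactly a McCallum certificate of level `M` (a derived point `P_n`, `n ∈ S(M+1)`, not
`3^{M+1}`-divisible), which by McCallum 1991 Cor. 5.6 (named fact `McCallum1991_pow_dvd_card_sha_primary_of_certificate`)
forces `3^{2(M₀ − M)} ∣ #Ш(E/K)[3^∞]`, `3^{M₀} ∥ y_K`; while BSD₃(E) ∧ BSD₃(E^{d_K}) and the tree's EXACT Gross–Zagier
bookkeeping give the co-STEP-L socket `ord₃ #Ш(E/K) + 2·ord₃ ∏c_ℓ(E) + 2·v₃(c) ≤ 2·ord₃ [E(K):ℤy_K] = 2M₀` (SOED's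
kernel theorem `WildKolyvaginUpperAtThreeTight.indexBounds_of_bsdp_of_partner_bsdp` in the rank-one orientation; §2 here
in the rank-zero orientation, Manin-free because `3 ∤ c`). Together: `M ≥ ord₃ ∏c_ℓ + v₃(c) ≥ s′ = M + 1`, absurd.
Consequences: (i) no counterexample to Σ★″ on an onto row exists short of a counterexample to BSD₃ on the leaf; (ii)
modulo {PUB⁺, S2, L₁, L₀} the research child Σ★″ is EQUIVALENT to the leaf on the onto rows (257 of 355 r1 classes,
N ≤ 5·10⁵); (iii) the budget `ord₃ ∏c_ℓ + v₃(c)` is forced — BSD predicts `M_∞` equal to it, so Σ★″ asks for no more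
divisibility than BSD supplies and no less than U₁/U₀ need.

WHAT IS PROVED (no definition, no named fact, no `sorry`; CONDITIONAL on the displayed named facts and on `BSD₃` of the
two members / the leaf taken as hypotheses; nothing is asserted about any curve):
* §1 `pDiv_of_bsdp_of_partner_bsdp_rankOne` — DATA level, rank-one orientation (`r_an(E) = 1`, `L(E^{d_K},1) ≠ 0`),
  any globally minimal non-CM `E` with `3 ∣ N` and `3`-adic tower onto, any datum: `BSDp E 3 ∧ BSDp Wd 3 ⟹ 3^{s′} ∣ P_n`
  for `s′ ≤ ord₃ ∏c_ℓ(E) + v₃|c|`, `n ∈ S(s′)`.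
* §2 `indexUpperBoundLeAt_rankZero_of_jointUpperBoundAt` (the rank-ZERO mirror of SOED's §1, slack `0`, `3 ∤ c`) and
  `pDiv_of_bsdp_of_partner_bsdp_rankZero` — rank-zero orientation (`r_an(E) = 0`, twist of analytic rank `1`).
* The CLASS-level, orientation-free statement (binders of Σ★″ VERBATIM plus `ρ̄_{E,3}` onto ⟹ `3^{s′} ∣ P_n`, from the
  leaf `WAllExclAddGssAtThree` + print, and from the four member items + print) is the sibling file
  `RamifiedHeegnerPairLeafSigmaStarTightOnto.lean`, which reads the orientation off the non-torsion Heegner point.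
References: [McCallumLMS1991] §5 Cor. 5.6, Lemma 5.1; [GrossZagier1986] I.(6.3), (7.3), V.(2.2); [Gross1991] (1.1),
Thm. 1.3, (2.3); [Jetchev2008] Conj. 1.3; [Miller2011LMS] Def. 1.1; [Mazur1978] Cor. 4.1.
-/

-- D-0017: single-problem summit, so `Summit.BirchSwinnertonDyer.BirchSwinnertonDyer.…` repeats a namespace BY DESIGN.
set_option linter.dupNamespace false
set_option autoImplicit false

noncomputable section

open scoped Classical NumberField

open WeierstrassCurve NumberField IsDedekindDomain Literature Literature.NumberTheory.EllipticCurves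
  Literature.NumberTheory.EllipticCurves.ModularForms
  Literature.NumberTheory.EllipticCurves.Rank1Residual
  Literature.NumberTheory.EllipticCurves.Rank1Residual.Typed
  Summit.BirchSwinnertonDyer.Rank1Residual
  Summit.BirchSwinnertonDyer.Rank1Residual.Additive
  Summit.BirchSwinnertonDyer.Rank1Residual.X11b
  Summit.BirchSwinnertonDyer.BirchSwinnertonDyer.Theses.RamifiedHeegnerPair
  Summit.BirchSwinnertonDyer.BirchSwinnertonDyer.Theorems

namespace Summit.BirchSwinnertonDyer.BirchSwinnertonDyer.Theorems.RamifiedPairUpperBound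

/-! ## §1 DATA level, rank-one orientation: BSD₃ of the pair forbids every certificate beyond the budget -/

/-- **Σ at one frame from `BSD₃(E) ∧ BSD₃(E^{d_K})`, rank-one orientation.** Data: `E/ℚ` globally minimal,
non-CM, `3 ∣ N_E`, the `3`-adic tower `ρ_{E,3^m}` onto for every `m`; `K` imaginary quadratic with odd `d_K`
satisfying the Heegner hypothesis for `N_E`, `L(E^{d_K}, 1) ≠ 0`, `r_an(E) = 1`; `(Dt, H, ι)` and the Heegner
point `P ∈ E(K)`; `Wd` a globally minimal model of the twist. Named facts as hypotheses: Gross–Zagier, Kolyvagin,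
GZK, modularity, Gross–Zagier I.(7.3), Shimura reciprocity at conductor `1`, Darmon Thm. 3.6, McCallum Cor. 5.6.
CONCLUSION: if `BSDp E 3` and `BSDp Wd 3` then for every `s′ ≤ ord₃ ∏c_ℓ(E) + v₃|c(Dt)|`, every square-free `n`
whose prime factors are Kolyvagin primes of index `≥ s′`, and every Kolyvagin–Heegner datum `d` of conductor `n`,
`3^{s′} ∣ P_n` in `E(K[n])`. Proof: a failure at `s′ = M + 1` is a McCallum certificate of level `M`, giving
`2(M₀ − M) ≤ ord₃ #Ш(E/K)` (`two_mul_sub_le_padicValNat_card_sha_primary_of_certificate`), while the two BSD₃'s give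
`ord₃ #Ш(E/K) + 2 ord₃∏c_ℓ + 2 v₃|c| ≤ 2 ord₃[E(K):ℤP] = 2M₀` (`indexBounds_of_bsdp_of_partner_bsdp`,
`padicValNat_index_zmultiples_eq_of_divisibility`). CONDITIONAL; nothing asserted.
[cite: McCallumLMS1991, §5 Cor. 5.6 (p. 310) and Lemma 5.1 (p. 303)] [cite: GrossZagier1986, Thm. I.(6.3) and (7.3)]
[cite: Miller2011LMS, Def. 1.1] -/
theorem pDiv_of_bsdp_of_partner_bsdp_rankOne
    (hGZ : ∀ (N : ℕ) [NeZero N] (W : WeierstrassCurve ℚ) (K : Type) [Field K] [NumberField K],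
      gross_zagier N W K)
    (hKo : ∀ (N : ℕ) [NeZero N] (W : WeierstrassCurve ℚ) (K : Type) [Field K] [NumberField K],
      kolyvagin N W K)
    (hGZK : rank_eq_analyticRank_of_analyticRank_le_one) (hmod : hasEntireLFunction_rat)
    (hGZ73 : GrossZagier1986_thm_I_7_3)
    (hrec : ∀ (N : ℕ) [NeZero N] (W : WeierstrassCurve ℚ) (K : Type) [Field K] [NumberField K],
      heegnerPointOfConductor_one_galoisConj N W K)
    (h36 : ∀ (N : ℕ) [NeZero N] (W : WeierstrassCurve ℚ) (K : Type) [Field K] [NumberField K],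
      phi_heegnerTau_mem_range_map_singularModuliField N W K)
    (hMc : McCallum1991_pow_dvd_card_sha_primary_of_certificate)
    (W : WeierstrassCurve ℚ) [W.IsElliptic] [W.IsGloballyMinimal] (N : ℕ) [NeZero N]
    (K : Type) [Field K] [NumberField K]
    (Dt : ModularParametrizationData W N) (H : HeegnerDatum N (NumberField.discr K)) (ι : K →+* ℂ)
    (P : (W.baseChange K).toAffine.Point)
    (hCM : ¬ W.HasCM) (h3N : 3 ∣ W.conductorNorm ℤ) (hN : W.conductorNorm ℤ = N)
    (hsurj : ∀ m : ℕ, W.HasSurjectiveModNGaloisRep (3 ^ m : ℕ))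
    (hK : IsImaginaryQuadratic K) (hHN : SatisfiesHeegnerHypothesis N K) (hodd : Odd (NumberField.discr K))
    (hr : W.analyticRank = 1) (hLt : (W.quadraticTwist (NumberField.discr K : ℚ)).entireLFunction 1 ≠ 0)
    (hP : WeierstrassCurve.Affine.Point.map ι.toRatAlgHom P = heegnerPointComplex Dt H)
    (Wd : WeierstrassCurve ℚ) [Wd.IsElliptic] [Wd.IsGloballyMinimal] (Cd : VariableChange ℚ)
    (hWd : Cd • W.quadraticTwist (NumberField.discr K : ℚ) = Wd)
    (hBW : BSDp W 3) (hBWd : BSDp Wd 3)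
    {s' : ℕ} (hs' : s' ≤ padicValNat 3 W.tamagawaProduct + padicValNat 3 Dt.c.natAbs)
    {n : ℕ} (d : KolyvaginHeegnerData Dt H.β ι n) (hn : Squarefree n)
    (hℓ : ∀ ℓ ∈ n.primeFactors, Zhang2014.IsKolyvaginPrime N W K 3 ℓ ∧ s' ≤ Zhang2014.kolyvaginIndex W 3 ℓ) :
    Three.Koly.PDiv d 3 s' := by
  haveI h3p : Fact (Nat.Prime 3) := ⟨Nat.prime_three⟩
  have hp2 : (3 : ℕ) ≠ 2 := by decide
  subst hN
  -- `s' = 0` is trivial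
  rcases Nat.eq_zero_or_pos s' with hs0 | hs0
  · subst hs0
    exact ⟨d.derivedPoint, by simp⟩
  obtain ⟨M, rfl⟩ : ∃ M, s' = M + 1 := ⟨s' - 1, by omega⟩
  by_contra hcert
  -- `3 ∣ N_W` splits in `K`: `3 ∤ d_K`, `3 ∤ #𝓞_K^×`; `d_K ≠ -3, -4`
  obtain ⟨hd3, hμ⟩ := X11b.Three.not_dvd_discr_and_not_dvd_torsionOrder_of_heegner hK hHN hp2 h3N
  have h3 : NumberField.discr K ≠ -3 := fun h ↦ hd3 (h ▸ ⟨-1, by norm_num⟩)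
  have h4 : NumberField.discr K ≠ -4 := fun h ↦ by
    rw [h] at hodd
    exact (Int.not_odd_iff_even.mpr ⟨-2, by norm_num⟩) hodd
  have hsurj3 : W.HasSurjectiveModNGaloisRep 3 := by simpa using hsurj 1
  have hirr : W.HasIrreducibleModPGaloisRep 3 :=
    hasIrreducibleModPGaloisRep_of_hasSurjectiveModNGaloisRep W 3 hsurj3
  -- the conductor-`1` Kolyvagin–Heegner datum (Darmon Thm. 3.6) with `P_1 = y_K = P` in `E(K̄)` (Shimura reciprocity)
  obtain ⟨d₁⟩ := nonempty_kolyvaginHeegnerData_one_of_darmon36 (h36 _ W K) hK Dt H.β ι H.dvd_sq_sub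
  have hPd : d₁.toGeomPoints d₁.derivedPoint = toGeomPoints (W.baseChange K) P :=
    KolyvaginBottom.toGeomPoints_derivedPoint_one_eq (hrec _ W K) hK hHN hP d₁ rfl
  -- `P` non-torsion (Gross–Zagier), rank one and `Ш(E/K)` finite (Kolyvagin)
  have hPinf : ¬ IsOfFinAddOrder P :=
    not_isOfFinAddOrder_of_heegner_of_analyticRank_eq_one W (W.conductorNorm ℤ) K Dt H ι P (hGZ _ W K) hmod hr hK
      hHN hLt hP
  obtain ⟨hrank, hSha⟩ := hKo (W.conductorNorm ℤ) W K hK hHN ⟨Dt, H, ι, hP⟩ hPinf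
  haveI : Finite (W.baseChange K).sha := hSha
  -- `E(K)[3] = 0`
  have hbot := torsionBy_eq_bot_of_isImaginaryQuadratic_of_hasIrreducibleModPGaloisRep W K hK Nat.prime_three hirr
  have hiv : ∀ x : (W.baseChange K).toAffine.Point, (3 : ℕ) • x = 0 → x = 0 := fun x hx ↦ by
    have hmem : x ∈ AddSubgroup.torsionBy (W.baseChange K).toAffine.Point (((3 : ℕ) : ℕ) : ℤ) := by
      rw [mem_torsionBy_iff, natCast_zsmul]
      exact hx
    rw [hbot] at hmem
    exact hmem
  -- `3^{M₀} ∥ P` in `E(K)`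
  haveI : Module.Finite ℤ (W.baseChange K).toAffine.Point := (W.baseChange K).module_finite_point_holds
  obtain ⟨M₀, x₀, hx₀, hmax⟩ := exists_pow_smul_eq_and_forall_ne hPinf (p := 3) Nat.prime_three.two_le
  have hdiv : ∃ Q : (W.baseChange K).toAffine.Point, ((3 ^ M₀ : ℕ) : ℤ) • Q = P :=
    ⟨x₀, by rw [natCast_zsmul]; exact hx₀⟩
  have hndiv : ¬ ∃ Q : (W.baseChange K).toAffine.Point, ((3 ^ (M₀ + 1) : ℕ) : ℤ) • Q = P := by
    rintro ⟨Q, hQ⟩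
    exact hmax Q (by rw [← natCast_zsmul]; exact hQ)
  -- McCallum Cor. 5.6 at the certificate: `2(M₀ − M) ≤ ord₃ #Ш(E/K)[3^∞]`
  have hMc' : 2 * (M₀ - M) ≤ padicValNat 3 (Nat.card (AddCommGroup.primaryComponent (W.baseChange K).sha 3)) :=
    two_mul_sub_le_padicValNat_card_sha_primary_of_certificate hMc W hCM K hK h3 h4 hHN 3 hp2 hsurj Dt H.β ι d₁ P
      hPd hPinf hdiv hndiv d hn hℓ hcert
  have hsha : padicValNat 3 (W.baseChange K).shaOrder =
      padicValNat 3 (Nat.card (AddCommGroup.primaryComponent (W.baseChange K).sha 3)) :=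
    Three.Koly.padicValNat_shaOrder_eq (W.baseChange K) 3
  -- `ord₃ [E(K) : ℤP] = M₀`
  haveI : Finite (AddCommGroup.torsion (W.baseChange K).toAffine.Point) :=
    WeierstrassCurve.finite_torsion_point (W := W.baseChange K)
  obtain ⟨c, Q, hcQ, hcker⟩ := RankOne.exists_coord_of_mordellWeilRank_eq_one (W.baseChange K) hrank
  have hidx : padicValNat 3 (AddSubgroup.zmultiples P).index = M₀ :=
    Three.Koly.padicValNat_index_zmultiples_eq_of_divisibility c Q hcQ hcker hiv P hdiv hndiv
  -- BSD₃ of the pair: the co-STEP-L socket at slack `v₃|c|`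
  obtain ⟨-, hup⟩ := WildKolyvaginUpperAtThreeTight.indexBounds_of_bsdp_of_partner_bsdp hGZ hKo hGZK hmod hGZ73 W 3
    (W.conductorNorm ℤ) K Dt H ι P Wd hr rfl h3N hK hodd hμ hHN hLt hP ⟨Cd, hWd⟩ hp2 hBW hBWd
  unfold SchneiderFree.Upper.IndexUpperBoundLeAt at hup
  rw [hidx, hsha] at hup
  omega

/-! ## §2 DATA level, rank-zero orientation: the co-STEP-L socket from the JOINT upper half (`3 ∤ c`), and Σ -/

/-- **JOINT upper ⟹ co-STEP L at slack `0`, rank-ZERO orientation** (mirror of SOED's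
`WildKolyvaginUpperAtThreeTight.indexUpperBoundLeAt_of_jointUpperBoundAt`): `r_an(E) = 0`, the twist `Wd ≃ E^{d_K}` of
analytic rank `1`, a datum with `p ∤ c(Dt)`; the tree's rank-zero Gross–Zagier bookkeeping
`AdditivePotMult.exists_shaAn_padicVal_eq_of_heegner_rankZero` (an EQUALITY
`ord q_d + ord q₀ + ord ∏c(Wd) + 2·ord #E(ℚ)_tors = 2·ord [E(K):ℤP]`), `#Ш_an(E) = q₀·#tors²/∏c(E)` (Wüthrich's
bookkeeping), `ord_p ∏c(Wd) = ord_p ∏c(E)` and the uniqueness of the rational `#Ш_an` turn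
`ord #Ш(E) + ord #Ш(Wd) ≤ ord #Ш_an(E) + ord #Ш_an(Wd)` into `ord_p #Ш(E/K) + 2·ord_p ∏c_ℓ(E) ≤ 2·ord_p [E(K):ℤP]`.
Facts by name as hypotheses; any odd `p ∣ N`. [cite: GrossZagier1986, Thm. I.(6.3) and V (2.2)]
[cite: JetchevSkinnerWan2017, §7.4.1 (arXiv:1512.06894 p. 30)] [cite: Miller2011LMS, Def. 1.1] -/
theorem indexUpperBoundLeAt_rankZero_of_jointUpperBoundAt
    (hGZ : ∀ (N : ℕ) [NeZero N] (W : WeierstrassCurve ℚ) (K : Type) [Field K] [NumberField K],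
      gross_zagier N W K)
    (hKo : ∀ (N : ℕ) [NeZero N] (W : WeierstrassCurve ℚ) (K : Type) [Field K] [NumberField K],
      kolyvagin N W K)
    (hGZK : rank_eq_analyticRank_of_analyticRank_le_one) (hmod : hasEntireLFunction_rat)
    (W : WeierstrassCurve ℚ) [W.IsElliptic] [W.IsGloballyMinimal] (p : ℕ) [Fact p.Prime]
    (N : ℕ) [NeZero N] (K : Type) [Field K] [NumberField K]
    (Dt : ModularParametrizationData W N) (H : HeegnerDatum N (NumberField.discr K)) (ι : K →+* ℂ)
    (P : (W.baseChange K).toAffine.Point) (Wd : WeierstrassCurve ℚ) [Wd.IsElliptic] [Wd.IsGloballyMinimal]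
    (hr : W.analyticRank = 0) (hN : W.conductorNorm ℤ = N) (hpN : p ∣ N) (hK : IsImaginaryQuadratic K)
    (hodd : Odd (NumberField.discr K)) (hw : ¬ p ∣ Units.torsionOrder K)
    (hHH : SatisfiesHeegnerHypothesis N K)
    (hP : WeierstrassCurve.Affine.Point.map ι.toRatAlgHom P = heegnerPointComplex Dt H)
    (Cd : VariableChange ℚ) (hWd : Cd • W.quadraticTwist (NumberField.discr K : ℚ) = Wd)
    (hrd : Wd.analyticRank = 1) (hp2 : p ≠ 2) (hc : ¬ (p : ℤ) ∣ Dt.c)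
    (hJ : SchneiderFree.Upper.JointUpperBoundAt W Wd p) :
    SchneiderFree.Upper.IndexUpperBoundLeAt W p K P 0 := by
  have hpp : p.Prime := Fact.out
  -- the joint upper half, with its two rationals
  obtain ⟨q', qd', hq', hqd', hle⟩ := hJ
  -- the curve's algebraic central value `L(E,1)/Ω_E ∈ ℚ` (from the rationality of `#Ш_an(E)` in rank zero)
  obtain ⟨q0, hq0⟩ := exists_ratio_rat_of_shaAn_rat_rankZero hGZK W hr hq'
  -- the twist's minimal model differs by a `p`-unit (`p ∣ N` splits in `K`)
  have hHp : SatisfiesHeegnerHypothesis p K := SatisfiesHeegnerHypothesis.of_dvd hpN hHH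
  have hu := AdditivePotMult.padicValRat_u_eq_zero_of_twist_minimal_of_split W p K hK hHp Cd hWd
  -- the rank-zero Gross–Zagier bookkeeping (an EQUALITY)
  obtain ⟨-, -, hsha, q, hq, hval⟩ := AdditivePotMult.exists_shaAn_padicVal_eq_of_heegner_rankZero W p N K Dt H ι P
    (hGZ N W K) (hKo N W K) hGZK hmod hK hHH hP hp2 hc hw hr Wd Cd hWd hu hrd q0 hq0
  -- `#Ш_an(E)` in rank zero
  have hL1 : W.entireLFunction 1 ≠ 0 := (analyticRank_eq_zero_iff_L_one_ne_zero_of_hasEntireLFunction_rat hmod W).mp hr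
  obtain ⟨-, hfin, -, hshaAnW⟩ := Wuthrich2014.shaAn_eq_of_L_one_div_eq hGZK W hL1 hq0
  haveI := hfin
  have hteq : W.torsionOrder = Nat.card W.toAffine.Point := W.torsionOrder_eq_natCard_of_finite
  -- Tamagawa transport (`p` odd, `p ∣ N` split in `K`)
  have hHN' : SatisfiesHeegnerHypothesis (W.conductorNorm ℤ) K := by rw [hN]; exact hHH
  have hpd : ¬ (p : ℤ) ∣ NumberField.discr K :=
    X11b.Three.not_dvd_discr_of_ncard_primesOver_eq_two hK.1 hp2 (hHH p hpp hpN)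
  have htam := X2.padicValNat_tamagawaProduct_twist_of_heegner_of_odd W p hp2 K hK hodd hpd hHN' Cd hWd
  -- identify the rationals
  have hqq : qd' = q := by exact_mod_cast hqd'.symm.trans hq
  have hq0q : q' = q0 * (Nat.card W.toAffine.Point : ℚ) ^ 2 / (W.tamagawaProduct : ℚ) := by
    exact_mod_cast hq'.symm.trans hshaAnW
  subst hqq hq0q
  have hq00 : q0 ≠ 0 := by
    intro h0
    apply hL1
    have hΩ : (W.realPeriodRat : ℂ) ≠ 0 := by exact_mod_cast W.realPeriodRat_pos_holds.ne'
    rw [h0, Rat.cast_zero, div_eq_zero_iff] at hq0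
    exact hq0.resolve_right hΩ
  have ht0 : (Nat.card W.toAffine.Point : ℚ) ≠ 0 := by exact_mod_cast (Nat.card_pos).ne'
  have hc0 : (W.tamagawaProduct : ℚ) ≠ 0 := by exact_mod_cast W.tamagawaProduct_pos_holds.ne'
  have hv : padicValRat p (q0 * (Nat.card W.toAffine.Point : ℚ) ^ 2 / (W.tamagawaProduct : ℚ)) =
      padicValRat p q0 + 2 * padicValNat p W.torsionOrder - padicValNat p W.tamagawaProduct := by
    rw [padicValRat.div (mul_ne_zero hq00 (pow_ne_zero _ ht0)) hc0, padicValRat.mul hq00 (pow_ne_zero _ ht0),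
      padicValRat.pow, padicValRat.of_nat, padicValRat.of_nat, hteq]
    push_cast; ring
  rw [hv] at hle
  unfold SchneiderFree.Upper.IndexUpperBoundLeAt
  have e2 : (padicValNat p (W.baseChange K).shaOrder : ℤ) =
      padicValNat p W.shaOrder + padicValNat p Wd.shaOrder := by exact_mod_cast hsha
  have e3 : (padicValNat p Wd.tamagawaProduct : ℤ) = padicValNat p W.tamagawaProduct := by exact_mod_cast htam
  have e1 : (padicValNat p (W.baseChange K).shaOrder : ℤ) + 2 * padicValNat p W.tamagawaProduct ≤
      2 * padicValNat p (AddSubgroup.zmultiples P).index := by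
    linarith
  omega

/-- **Σ at one frame from `BSD₃(E) ∧ BSD₃(E^{d_K})`, rank-ZERO orientation.** Same data as
`pDiv_of_bsdp_of_partner_bsdp_rankOne` but `r_an(E) = 0`, the minimal twist model `Wd` of analytic rank `1`, `P`
non-torsion, and a datum with `3 ∤ c(Dt)` (so the budget is `ord₃ ∏c_ℓ(E)` and Σ is Manin-free). CONCLUSION:
`BSDp E 3 ∧ BSDp Wd 3 ⟹ 3^{s′} ∣ P_n` for `s′ ≤ ord₃ ∏c_ℓ(E) + v₃|c| (= ord₃ ∏c_ℓ(E))`, `n ∈ S(s′)`. Same proof as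
§1 with §2's socket. CONDITIONAL; nothing asserted. [cite: McCallumLMS1991, §5 Cor. 5.6 (p. 310) and Lemma 5.1 (p. 303)]
[cite: GrossZagier1986, Thm. I.(6.3) and V (2.2)] [cite: Miller2011LMS, Def. 1.1] -/
theorem pDiv_of_bsdp_of_partner_bsdp_rankZero
    (hGZ : ∀ (N : ℕ) [NeZero N] (W : WeierstrassCurve ℚ) (K : Type) [Field K] [NumberField K],
      gross_zagier N W K)
    (hKo : ∀ (N : ℕ) [NeZero N] (W : WeierstrassCurve ℚ) (K : Type) [Field K] [NumberField K],
      kolyvagin N W K)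
    (hGZK : rank_eq_analyticRank_of_analyticRank_le_one) (hmod : hasEntireLFunction_rat)
    (hrec : ∀ (N : ℕ) [NeZero N] (W : WeierstrassCurve ℚ) (K : Type) [Field K] [NumberField K],
      heegnerPointOfConductor_one_galoisConj N W K)
    (h36 : ∀ (N : ℕ) [NeZero N] (W : WeierstrassCurve ℚ) (K : Type) [Field K] [NumberField K],
      phi_heegnerTau_mem_range_map_singularModuliField N W K)
    (hMc : McCallum1991_pow_dvd_card_sha_primary_of_certificate)
    (W : WeierstrassCurve ℚ) [W.IsElliptic] [W.IsGloballyMinimal] (N : ℕ) [NeZero N]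
    (K : Type) [Field K] [NumberField K]
    (Dt : ModularParametrizationData W N) (H : HeegnerDatum N (NumberField.discr K)) (ι : K →+* ℂ)
    (P : (W.baseChange K).toAffine.Point)
    (hCM : ¬ W.HasCM) (h3N : 3 ∣ W.conductorNorm ℤ) (hN : W.conductorNorm ℤ = N)
    (hsurj : ∀ m : ℕ, W.HasSurjectiveModNGaloisRep (3 ^ m : ℕ))
    (hK : IsImaginaryQuadratic K) (hHN : SatisfiesHeegnerHypothesis N K) (hodd : Odd (NumberField.discr K))
    (hr : W.analyticRank = 0)
    (hP : WeierstrassCurve.Affine.Point.map ι.toRatAlgHom P = heegnerPointComplex Dt H)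
    (hnt : ¬ IsOfFinAddOrder P) (hc : ¬ (3 : ℤ) ∣ Dt.c)
    (Wd : WeierstrassCurve ℚ) [Wd.IsElliptic] [Wd.IsGloballyMinimal] (Cd : VariableChange ℚ)
    (hWd : Cd • W.quadraticTwist (NumberField.discr K : ℚ) = Wd) (hrd : Wd.analyticRank = 1)
    (hBW : BSDp W 3) (hBWd : BSDp Wd 3)
    {s' : ℕ} (hs' : s' ≤ padicValNat 3 W.tamagawaProduct + padicValNat 3 Dt.c.natAbs)
    {n : ℕ} (d : KolyvaginHeegnerData Dt H.β ι n) (hn : Squarefree n)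
    (hℓ : ∀ ℓ ∈ n.primeFactors, Zhang2014.IsKolyvaginPrime N W K 3 ℓ ∧ s' ≤ Zhang2014.kolyvaginIndex W 3 ℓ) :
    Three.Koly.PDiv d 3 s' := by
  haveI h3p : Fact (Nat.Prime 3) := ⟨Nat.prime_three⟩
  have hp2 : (3 : ℕ) ≠ 2 := by decide
  subst hN
  rcases Nat.eq_zero_or_pos s' with hs0 | hs0
  · subst hs0
    exact ⟨d.derivedPoint, by simp⟩
  obtain ⟨M, rfl⟩ : ∃ M, s' = M + 1 := ⟨s' - 1, by omega⟩
  by_contra hcert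
  obtain ⟨hd3, hμ⟩ := X11b.Three.not_dvd_discr_and_not_dvd_torsionOrder_of_heegner hK hHN hp2 h3N
  have h3 : NumberField.discr K ≠ -3 := fun h ↦ hd3 (h ▸ ⟨-1, by norm_num⟩)
  have h4 : NumberField.discr K ≠ -4 := fun h ↦ by
    rw [h] at hodd
    exact (Int.not_odd_iff_even.mpr ⟨-2, by norm_num⟩) hodd
  have hsurj3 : W.HasSurjectiveModNGaloisRep 3 := by simpa using hsurj 1
  have hirr : W.HasIrreducibleModPGaloisRep 3 :=
    hasIrreducibleModPGaloisRep_of_hasSurjectiveModNGaloisRep W 3 hsurj3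
  obtain ⟨d₁⟩ := nonempty_kolyvaginHeegnerData_one_of_darmon36 (h36 _ W K) hK Dt H.β ι H.dvd_sq_sub
  have hPd : d₁.toGeomPoints d₁.derivedPoint = toGeomPoints (W.baseChange K) P :=
    KolyvaginBottom.toGeomPoints_derivedPoint_one_eq (hrec _ W K) hK hHN hP d₁ rfl
  obtain ⟨hrank, hSha⟩ := hKo (W.conductorNorm ℤ) W K hK hHN ⟨Dt, H, ι, hP⟩ hnt
  haveI : Finite (W.baseChange K).sha := hSha
  have hbot := torsionBy_eq_bot_of_isImaginaryQuadratic_of_hasIrreducibleModPGaloisRep W K hK Nat.prime_three hirr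
  have hiv : ∀ x : (W.baseChange K).toAffine.Point, (3 : ℕ) • x = 0 → x = 0 := fun x hx ↦ by
    have hmem : x ∈ AddSubgroup.torsionBy (W.baseChange K).toAffine.Point (((3 : ℕ) : ℕ) : ℤ) := by
      rw [mem_torsionBy_iff, natCast_zsmul]
      exact hx
    rw [hbot] at hmem
    exact hmem
  haveI : Module.Finite ℤ (W.baseChange K).toAffine.Point := (W.baseChange K).module_finite_point_holds
  obtain ⟨M₀, x₀, hx₀, hmax⟩ := exists_pow_smul_eq_and_forall_ne hnt (p := 3) Nat.prime_three.two_le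
  have hdiv : ∃ Q : (W.baseChange K).toAffine.Point, ((3 ^ M₀ : ℕ) : ℤ) • Q = P :=
    ⟨x₀, by rw [natCast_zsmul]; exact hx₀⟩
  have hndiv : ¬ ∃ Q : (W.baseChange K).toAffine.Point, ((3 ^ (M₀ + 1) : ℕ) : ℤ) • Q = P := by
    rintro ⟨Q, hQ⟩
    exact hmax Q (by rw [← natCast_zsmul]; exact hQ)
  have hMc' : 2 * (M₀ - M) ≤ padicValNat 3 (Nat.card (AddCommGroup.primaryComponent (W.baseChange K).sha 3)) :=
    two_mul_sub_le_padicValNat_card_sha_primary_of_certificate hMc W hCM K hK h3 h4 hHN 3 hp2 hsurj Dt H.β ι d₁ P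
      hPd hnt hdiv hndiv d hn hℓ hcert
  have hsha : padicValNat 3 (W.baseChange K).shaOrder =
      padicValNat 3 (Nat.card (AddCommGroup.primaryComponent (W.baseChange K).sha 3)) :=
    Three.Koly.padicValNat_shaOrder_eq (W.baseChange K) 3
  haveI : Finite (AddCommGroup.torsion (W.baseChange K).toAffine.Point) :=
    WeierstrassCurve.finite_torsion_point (W := W.baseChange K)
  obtain ⟨c, Q, hcQ, hcker⟩ := RankOne.exists_coord_of_mordellWeilRank_eq_one (W.baseChange K) hrank
  have hidx : padicValNat 3 (AddSubgroup.zmultiples P).index = M₀ :=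
    Three.Koly.padicValNat_index_zmultiples_eq_of_divisibility c Q hcQ hcker hiv P hdiv hndiv
  -- `v₃|c| = 0`
  have hc0 : padicValNat 3 Dt.c.natAbs = 0 :=
    padicValNat.eq_zero_of_not_dvd fun h ↦ hc (Int.ofNat_dvd_left.mpr h)
  -- the JOINT upper half from the two BSD₃'s, then §2's socket
  have hJ : SchneiderFree.Upper.JointUpperBoundAt W Wd 3 :=
    WildKolyvaginUpperAtThreeTight.jointUpperBoundAt_of_bsdp_of_bsdp hGZK W Wd 3 (by rw [hr]; exact zero_le_one)
      (by rw [hrd]) hBW hBWd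
  have hup := indexUpperBoundLeAt_rankZero_of_jointUpperBoundAt hGZ hKo hGZK hmod W 3 (W.conductorNorm ℤ) K Dt H ι P
    Wd hr rfl h3N hK hodd hμ hHN hP Cd hWd hrd hp2 hc hJ
  unfold SchneiderFree.Upper.IndexUpperBoundLeAt at hup
  rw [hidx, hsha] at hup
  omega

end Summit.BirchSwinnertonDyer.BirchSwinnertonDyer.Theorems.RamifiedPairUpperBound

end
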